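import Summits.QuantumFields.YangMills.Theorems.AllWindowsColdBoxBoxWindowHighSU2213LineDefs
import Summits.QuantumFields.YangMills.Theorems.AllWindowsColdBoxBoxHighLineLandauBallQuaternion
import Summits.QuantumFields.YangMills.Theorems.AllWindowsColdBoxBoxHighLineLandauBallEdge
import Summits.QuantumFields.YangMills.Theorems.AllWindowsColdBoxBoxHighLineLandauBallSums

/-!
# LINE-20 stub U3 BY NAME: `stub_landauBallUniqueness : LandauBallUniqueness` — Gribov uniqueness of the lattice Landau gauge in the
# small gauge ball, with the SHARP radius condition `r·H ≤ c₀` (`c₀ = 1/32`)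

Registered stub U3 of LINE-20 «landau-rung3» (planner ym-idea-2 g17; skeleton v2 `Cruxes/BoxWindowHighSU2213/Lines/landau_rung3.lean`, sha16
`087a0f4e9ce4ecb4`) on the HIGH item `AllWindowsColdBox.BoxWindowHighSU2213` ⟨stmt-QuantumFields-24336⟩ (parent crux ⟨stmt-QuantumFields-24004⟩
`BoxHighWindowsSU22`); the Prop `LandauBallUniqueness` is the tree copy ✓`…AllWindowsColdBoxBoxWindowHighSU2213LineDefs` (verbatim from the skeleton).

STATEMENT.  There is `c₀ > 0` (here `1/32`) such that for every `H ≥ 1`, `0 ≤ r`, `r·H ≤ c₀`, every configuration `U` and every two INTERIOR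
gauge transformations `g, g'` (identity off `[1, 2H−1]⁴`) such that both `U^g` and `U^{g'}` have all cold-box links within defect `r²` of the identity
and both are in lattice Landau gauge, `g = g'`.

PROOF (monotonicity pairing; no exponential map, no second variation).  Put `h := g'·g⁻¹` (interior), `V := U^g`, `W := U^{g'}`, so
`W_e = h_x V_e h_y⁻¹` on every edge `e = (x → y)`; in the quaternion model `ψ_x := q(h_x)`, `q(W_e) = ψ_x q(V_e) ψ̄_y`
(✓`LandauBall.su2Quat_mul_mul_inv`).  (1) `‖q(V_e) − 1‖, ‖q(W_e) − 1‖ ≤ r` on box edges (`linkDefect = ‖q − 1‖²`, ✓`linkDefect_eq_norm_sq`), hence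
`‖ψ_x − ψ_y‖ ≤ 2r` (✓`norm_sub_le_of_transform`) and, walking down axis 0 to the frozen layer, `‖ψ_x − 1‖ ≤ 4rH ≤ 1/8`, so `Re ψ_x ≥ 7/8`
(✓`norm_sub_one_le_of_edges`, ✓`one_sub_norm_le_re`).  (2) The lattice Landau conditions of `V` and `W` say `Σ_μ Im q(·)(x,μ) = Σ_μ Im q(·)(x−e_μ,μ)`
at interior sites (✓`sum_im_su2Quat_eq_of_inLandauGauge`); pairing their difference with the test field `φ_x := Im ψ_x` (which vanishes off the
interior) and summing by parts (✓`sum_inner_div_eq_sum_edges`) gives `Σ_{e ∈ box} ⟪φ_x − φ_y, Im q(W_e) − Im q(V_e)⟫ = 0`.  (3) Per edge,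
✓`edge_pairing_lower_sq`: `(5/8)‖φ_x − φ_y‖² − 4r²(‖φ_x‖² + ‖φ_y‖²) ≤ ⟪φ_x − φ_y, Im q(W_e) − Im q(V_e)⟫` (the exact identity
`⟪Im x − Im y, Im(xȳ)⟫ = c_y|u|² + c_x|v|² − (c_x + c_y)u·v ≥ ½(c_x + c_y)|u − v|²` plus a second-order remainder).  (4) Summing, with edge
multiplicity `≤ 8` (✓`sum_edges_endpoints_le`) and the Dirichlet Poincaré inequality `Σ‖φ‖² ≤ 4H² Σ_e ‖dφ‖²` (✓`sum_norm_sq_le_poincare`):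
`(5/8)D ≤ 32 r² S ≤ 128 (rH)² D ≤ D/8`, so `D = S = 0`: `Im ψ ≡ 0`, and with `Re ψ ≥ 7/8`, `ψ ≡ 1` (✓`eq_one_of_im_su2Quat_eq_zero`), i.e.
`h ≡ 1`, `g = g'`.

Everything proved; no definitions; standard axioms.  HONEST LABEL: ONE registered stub (U3, M, deterministic) of a critic-stamped DRAFT-by-design
line on the R2ξ″ all-windows crux; the other stubs U1/U2/U5 (and the declared residual U6) are OPEN; ⟨24336⟩, ⟨24004⟩ stay OPEN; no crux, rung
or summit is proved; the Yang–Mills mass gap is NOT proved by this file.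
-/

set_option autoImplicit false

noncomputable section

open Finset Quaternion
open Literature.MathematicalPhysics.QuantumFieldTheory.AxialGauge (boxEdges)
open Literature.MathematicalPhysics.QuantumLattice (su2Quat quatMatrix quatMatrix_su2Quat quatMatrix_one norm_su2Quat gaugeTransformZd
  LGConfig ZdEdge)
open Literature.MathematicalPhysics.QuantumFieldTheory (quatMatrix_injective)
open Literature.Probability.LatticeModels (Site)
open Summit.QuantumFields.YangMills.Theorems.AllWindowsColdBoxBoxHighLine.LandauBall

namespace Summit.QuantumFields.YangMills.Theorems.AllWindowsColdBoxBoxHighLine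

/-- **LINE-20 U3 by name: Gribov uniqueness of the lattice Landau gauge in the small gauge ball (`c₀ = 1/32`).**  Two interior gauge
transformations that both put `U` in lattice Landau gauge with all cold-box links within defect `r²` of the identity coincide, as soon as
`r·H ≤ 1/32`. -/
theorem stub_landauBallUniqueness : LandauBallUniqueness := by
  refine ⟨1 / 32, by norm_num, ?_⟩
  intro H hH r hr hrH U g g' hg hg' hdg hdg' hLg hLg'
  set V : LGConfig 4 SU2 := gaugeTransformZd g U with hV
  set W : LGConfig 4 SU2 := gaugeTransformZd g' U with hW
  -- the relative gauge transformation `h = g'·g⁻¹` and its quaternion field `ψ`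
  set h : Site 4 → SU2 := fun x => g' x * (g x)⁻¹ with hh
  have hh1 : ∀ x, x ∉ interiorSites H → h x = 1 := fun x hx => by simp [hh, hg x hx, hg' x hx]
  have hWh : ∀ e : ZdEdge 4, W e = h e.1 * V e * (h (e.1 + Pi.single e.2 1))⁻¹ := by
    intro e
    simp only [hW, hV, hh, gaugeTransformZd]
    group
  have hone : su2Quat (1 : SU2) = 1 := by
    apply quatMatrix_injective
    rw [quatMatrix_su2Quat, quatMatrix_one]
    rfl
  set ψ : Site 4 → ℍ := fun x => su2Quat (h x) with hψ
  have hψ1 : ∀ x, x ∉ interiorSites H → ψ x = 1 := fun x hx => by simp only [hψ, hh1 x hx, hone]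
  have hnorm : ∀ x, ‖ψ x‖ = 1 := fun x => norm_su2Quat _
  have hqW : ∀ e : ZdEdge 4, su2Quat (W e) = ψ e.1 * su2Quat (V e) * star (ψ (e.1 + Pi.single e.2 1)) := by
    intro e; rw [hWh e, su2Quat_mul_mul_inv]
  -- (1) link bounds on box edges, the edge bound and the sup bound
  have hVr : ∀ e ∈ boxEdges 4 (2 * H + 1), ‖su2Quat (V e) - 1‖ ≤ r := fun e he => norm_su2Quat_sub_one_le hr (hdg e he)
  have hWr : ∀ e ∈ boxEdges 4 (2 * H + 1), ‖su2Quat (W e) - 1‖ ≤ r := fun e he => norm_su2Quat_sub_one_le hr (hdg' e he)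
  have hedge : ∀ e ∈ boxEdges 4 (2 * H + 1), ‖ψ e.1 - ψ (e.1 + Pi.single e.2 1)‖ ≤ 2 * r := by
    intro e he
    have h1 := norm_sub_le_of_transform (su2Quat (V e)) (hnorm e.1) (hnorm (e.1 + Pi.single e.2 1))
    rw [← hqW e] at h1
    linarith [hVr e he, hWr e he]
  have hsup : ∀ x, ‖ψ x - 1‖ ≤ 4 * r * H := norm_sub_one_le_of_edges hr ψ hψ1 hedge
  have hH1 : (1 : ℝ) ≤ H := by exact_mod_cast hH
  have hrH' : 4 * r * (H : ℝ) ≤ 1 / 8 := by linarith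
  have hre : ∀ x, 7 / 8 ≤ (ψ x).re := fun x => by
    have h1 := one_sub_norm_le_re (ψ x)
    linarith [hsup x]
  -- (2) the test field `φ = Im ψ` and the summed Landau identities
  set φ : Site 4 → ℍ := fun x => (ψ x).im with hφ
  have hφ0 : ∀ x, x ∉ interiorSites H → φ x = 0 := fun x hx => by simp only [hφ, hψ1 x hx, im_one]
  set F : ZdEdge 4 → ℍ := fun e => (su2Quat (W e)).im - (su2Quat (V e)).im with hF
  have hdiv : ∀ x ∈ interiorSites H, ∑ μ : Fin 4, (F (x, μ) - F (x - Pi.single μ 1, μ)) = 0 := by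
    intro x hx
    have h1 := sum_im_su2Quat_eq_of_inLandauGauge hLg' hx
    have h2 := sum_im_su2Quat_eq_of_inLandauGauge hLg hx
    simp only [hF, Finset.sum_sub_distrib, h1, h2, sub_self]
  have hzero : ∑ e ∈ boxEdges 4 (2 * H + 1), inner ℝ (φ e.1 - φ (e.1 + Pi.single e.2 1)) (F e) = 0 := by
    rw [← sum_inner_div_eq_sum_edges φ hφ0 F]
    exact Finset.sum_eq_zero fun x hx => by rw [hdiv x hx, inner_zero_right]
  -- (3) the per-edge lower bound
  have hper : ∀ e ∈ boxEdges 4 (2 * H + 1),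
      5 / 8 * ‖φ e.1 - φ (e.1 + Pi.single e.2 1)‖ ^ 2 - 4 * r ^ 2 * (‖φ e.1‖ ^ 2 + ‖φ (e.1 + Pi.single e.2 1)‖ ^ 2) ≤
        inner ℝ (φ e.1 - φ (e.1 + Pi.single e.2 1)) (F e) := by
    intro e he
    have h1 := edge_pairing_lower_sq (V := su2Quat (V e)) (hnorm e.1) (hnorm (e.1 + Pi.single e.2 1)) (hre _) (hre _) (hVr e he)
    rw [← hqW e] at h1
    simpa only [hφ, hF, im_sub] using h1
  -- (4) sum, edge multiplicity, Poincaré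
  have hsum := Finset.sum_le_sum hper
  rw [hzero, Finset.sum_sub_distrib, ← Finset.mul_sum, ← Finset.mul_sum] at hsum
  have hmult := sum_edges_endpoints_le (H := H) (fun x => ‖φ x‖ ^ 2) (fun x => sq_nonneg _)
    (fun x hx => by simp only [hφ0 x hx, norm_zero]; ring)
  have hP := sum_norm_sq_le_poincare (H := H) φ hφ0
  have hDD : ∑ e ∈ boxEdges 4 (2 * H + 1), ‖φ (e.1 + Pi.single e.2 1) - φ e.1‖ ^ 2 =
      ∑ e ∈ boxEdges 4 (2 * H + 1), ‖φ e.1 - φ (e.1 + Pi.single e.2 1)‖ ^ 2 :=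
    Finset.sum_congr rfl fun e _ => by rw [norm_sub_rev]
  rw [hDD] at hP
  set D := ∑ e ∈ boxEdges 4 (2 * H + 1), ‖φ e.1 - φ (e.1 + Pi.single e.2 1)‖ ^ 2 with hD
  set S := ∑ x ∈ interiorSites H, ‖φ x‖ ^ 2 with hS
  have hD0 : 0 ≤ D := Finset.sum_nonneg fun e _ => sq_nonneg _
  have hS0 : 0 ≤ S := Finset.sum_nonneg fun x _ => sq_nonneg _
  have hrH2 : r ^ 2 * (H : ℝ) ^ 2 ≤ 1 / 1024 := by
    have h1 : r * (H : ℝ) ≤ 1 / 32 := hrH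
    have h2 : 0 ≤ r * (H : ℝ) := by positivity
    nlinarith
  -- (5/8) D ≤ 4 r² · 8 S ≤ 32 r² · 4H² D ≤ D/8  ⇒  D = 0, S = 0
  have hD8 : 5 / 8 * D ≤ 32 * r ^ 2 * S := by nlinarith [hmult, hsum, sq_nonneg r]
  have hSD : S ≤ 4 * (H : ℝ) ^ 2 * D := hP
  have hDle : 5 / 8 * D ≤ 1 / 8 * D := by nlinarith [hD8, hSD, hrH2, sq_nonneg r]
  have hDz : D = 0 := by linarith
  have hSz : S = 0 := by
    have : S ≤ 0 := by rw [hDz, mul_zero] at hSD; exact hSD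
    linarith
  -- (5) conclude: `Im ψ ≡ 0`, `Re ψ > 0` ⇒ `h ≡ 1` ⇒ `g = g'`
  have hφz : ∀ x ∈ interiorSites H, φ x = 0 := by
    intro x hx
    have h1 := (Finset.sum_eq_zero_iff_of_nonneg (fun y _ => sq_nonneg ‖φ y‖)).1 hSz x hx
    simpa using h1
  funext x
  by_cases hx : x ∈ interiorSites H
  · have h1 : h x = 1 := eq_one_of_im_su2Quat_eq_zero (hφz x hx) (by linarith [hre x])
    have h2 : g' x * (g x)⁻¹ = 1 := h1
    exact (mul_inv_eq_one.1 h2).symm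
  · rw [hg x hx, hg' x hx]

end Summit.QuantumFields.YangMills.Theorems.AllWindowsColdBoxBoxHighLine

end
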